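import Literature.Barriers.PneNP.MatchingSlackPsdApproximationProof
import HarnessLib

/-!
# Rothvoß 2017, Theorem 1: the perfect matching polytope has extension complexity `2^{Ω(n)}`
# — for all large even `n`

T. Rothvoß, *The matching polytope has exponential extension complexity*, J. ACM 64 (2017) =
arXiv:1311.2369 [Rothvoss2017] (held), **Theorem 1** (PDF p. 4, verbatim): "For all even `n`, the
extension complexity of the perfect matching polytope in the complete `n`-node graph is `2^{Ω(n)}`."

The tree proves Rothvoß's argument on the structured vertex type `Slot m 72` (`n = 216m + 150`,
`m = 2μ + 1` large): `pm_bound` / `exists_WK_fin` (`TSPExtensionComplexityRothvossProofs/Kernel.lean`)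
give `1 ≤ (R + 1)(t − 1)·2·2^{−δm}` for an extended formulation of `P_PM(n)` with `R` inequalities AT
THESE SLOT SIZES, and `Rothvoss2017_tsp_holds` derives Cor. 2 (TSP, all large `n`) from them through the
matching face of the TSP polytope.  The statement for `P_PM(n)` itself at the INTERMEDIATE even `n` was
not in the tree; it follows from the padding `K_{216m+150} ⊆ K_n` of the odd-cut slack matrix
(`KLWApprox.padRow/padCol/cc_pad`, `MatchingSlackPsdApproximationProof.lean` Part F: the slack matrix of
`K_{n'}` is a submatrix of that of `K_{n'+2d}`), the all-even-`n` nonnegative-rank floor proved there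
(`KLWApprox.klwPerturbation_nonnegRank_all`, applied to the unperturbed `S̃ = S`), and Yannakakis'
factorisation theorem in the tree's form (`HasEFOfSize.exists_nonneg_factorization`: an EF with `r`
inequalities factors every slack matrix of valid inequalities × points through `r + 1` nonnegative
coordinates).  This file PROVES (no named facts):

* `hasNonnegFactorization_pmOddCutSlack_of_hasEF` — an EF of `P_PM(n)` of size `r` gives a
  nonnegative factorisation of size `r + 1` of the odd-cut slack matrix `pmOddCutSlack n`
  (`S_{UM} = |δ(U) ∩ M| − 1`, rows `OddSet n`, columns `PMatch n`);
* `Rothvoss2017_thm1_nonnegRank` — `∃ c > 0`, for all large even `n`: `rk₊(S) ≥ 2^{cn}`;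
* `Rothvoss2017_thm1` — **Theorem 1**: `∃ c > 0`, eventually in `n`, for even `n` every extended
  formulation of `pmPolytope n` has `≥ 2^{cn}` inequalities (same currency `HasEFOfSize` and same
  `∃ c, ∀ᶠ n` shape as the tree's `Rothvoss2017_tsp`; `c = δ_R/864` from the slot-model constant).

Scope: `n` even and large (for `n = 2` the polytope is a point and has an EF with `0` inequalities, so
"for all even `n`" is read, as printed, with the `Ω`-constant absorbing small `n` — here as `∀ᶠ n`).
-/

noncomputable section

namespace Literature.Barriers.PneNP

open Finset Filter
open Literature.Combinatorics.Optimization (HasNonnegFactorization)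
open Literature.Combinatorics.SimpleGraph.CycleSpace (Crosses crosses_mk)

/-- A pair crosses `U` iff it has exactly one endpoint in `U`. [folklore] -/
private theorem crosses_iff_cutCount_one {n : ℕ} (U : Finset (Fin n)) (e : Sym2 (Fin n)) :
    Crosses U e ↔ cutCount U e = 1 := by
  induction e using Sym2.ind with
  | h a b =>
    rw [crosses_mk, cutCount_mk]
    by_cases ha : a ∈ U <;> by_cases hb : b ∈ U <;> simp [ha, hb]

/-- `cc U M` in `cutCount` form. [folklore] -/
private theorem cc_eq_card_cutCount {n : ℕ} (U : OddSet n) (M : PMatch n) :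
    cc U M = (M.1.filter fun e => cutCount U.1 e = 1).card := by
  unfold cc
  rw [Finset.filter_congr fun e (_ : e ∈ M.1) => crosses_iff_cutCount_one U.1 e]

/-- **Yannakakis' factorisation (lower-bound direction) for the odd-cut slack matrix**: an extended
formulation of `P_PM(n)` with `r` inequalities gives a nonnegative factorisation of size `r + 1` of
`S_{UM} = |δ(U) ∩ M| − 1` (odd `U`, perfect matchings `M`; the odd-set inequalities `x(δ(U)) ≥ 1` are
valid on `P_PM(n)`, `oddCutVec_le`, with slack `|δ(U) ∩ M| − 1` at `χ^M`, `oddCut_slack`).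
[cite: Rothvoss2017, Thm. 4 and §2 (PDF p. 5)] -/
theorem hasNonnegFactorization_pmOddCutSlack_of_hasEF {n r : ℕ} (h : HasEFOfSize (pmPolytope n) r) :
    HasNonnegFactorization (pmOddCutSlack n) (r + 1) := by
  classical
  obtain ⟨U, T, hU, hT, hfac⟩ := h.exists_nonneg_factorization (A := OddSet n) (B := PMatch n)
    (fun b => charVec (b : Finset (Sym2 (Fin n)))) (fun b => charVec_mem_pmPolytope b.2)
    (fun a => oddCutVec (a : Finset (Fin n))) (fun _ => -1)
    (fun a => oddCutVec_le _ a.2)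
  refine ⟨fun a l => U a (finSuccEquiv r l), fun l b => T b (finSuccEquiv r l), fun a l => hU _ _,
    fun l b => hT _ _, fun a b => ?_⟩
  have h1 := hfac a b
  rw [oddCut_slack _ b.2] at h1
  rw [pmOddCutSlack_apply, cc_eq_card_cutCount, h1]
  exact (Fintype.sum_equiv (finSuccEquiv r)
    (fun l => U a (finSuccEquiv r l) * T b (finSuccEquiv r l)) (fun i => U a i * T b i) fun _ => rfl).symm

/-- **Nonnegative rank of the odd-cut slack matrix, all large even `n`**: `∃ c > 0` with
`rk₊(S) ≥ 2^{cn}` — `KLWApprox.klwPerturbation_nonnegRank_all` at the unperturbed `S̃ = S`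
(`isKLWPerturbation_self`).  By Yannakakis' theorem this is `xc(P_PM(n)) ≥ 2^{Ω(n)}` read on the slack
matrix. [cite: Rothvoss2017, Thm. 1 and Thm. 4 (PDF pp. 4–5)] -/
theorem Rothvoss2017_thm1_nonnegRank :
    ∃ c : ℝ, 0 < c ∧ ∀ᶠ n : ℕ in atTop, Even n → ∀ r : ℕ,
      HasNonnegFactorization (pmOddCutSlack n) r → (2 : ℝ) ^ (c * n) ≤ r := by
  obtain ⟨c, hc, H⟩ := KLWApprox.klwPerturbation_nonnegRank_all
  obtain ⟨n₀, hn₀⟩ := H 1 one_pos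
  refine ⟨c, hc, ?_⟩
  filter_upwards [eventually_ge_atTop n₀] with n hn he r hr
  exact hn₀ n hn he (pmOddCutSlack n) (isKLWPerturbation_self n) r hr

/-- **Rothvoß 2017, Theorem 1** ("For all even `n`, the extension complexity of the perfect matching
polytope in the complete `n`-node graph is `2^{Ω(n)}`"), in the tree's currency: there is `c > 0` such
that for all large `n`, if `n` is even then every extended formulation of `P_PM(n)` (`pmPolytope n`)
has at least `2^{cn}` inequalities.  Proof: an EF with `r` inequalities gives `rk₊(S) ≤ r + 1`
(`hasNonnegFactorization_pmOddCutSlack_of_hasEF`), `rk₊(S) ≥ 2^{c₀ n}` (`Rothvoss2017_thm1_nonnegRank`,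
i.e. Lemmas 5–6 on the slot model + padding), and `2·2^{c₀n/2} ≤ 2^{c₀ n} ≤ r + 1 ≤ 2r` once
`n ≥ 2/c₀`; `c = c₀/2`. [cite: Rothvoss2017, Thm. 1 (PDF p. 4)] -/
theorem Rothvoss2017_thm1 :
    ∃ c : ℝ, 0 < c ∧ ∀ᶠ n : ℕ in atTop, Even n → ∀ r : ℕ, HasEFOfSize (pmPolytope n) r →
      (2 : ℝ) ^ (c * n) ≤ r := by
  obtain ⟨c, hc, hev⟩ := Rothvoss2017_thm1_nonnegRank
  refine ⟨c / 2, by positivity, ?_⟩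
  filter_upwards [hev, eventually_ge_atTop ⌈2 / c⌉₊] with n hn hn' he r hr
  have h1 := hn he (r + 1) (hasNonnegFactorization_pmOddCutSlack_of_hasEF hr)
  push_cast at h1
  -- `2 · 2^{(c/2) n} ≤ 2^{c n} ≤ r + 1 ≤ 2 r`
  have hn2 : 2 / c ≤ (n : ℝ) := (Nat.le_ceil _).trans (by exact_mod_cast hn')
  have hcn : 1 ≤ c / 2 * n := by
    rw [div_le_iff₀ hc] at hn2
    linarith
  have hpow : 2 * (2 : ℝ) ^ (c / 2 * n) ≤ (2 : ℝ) ^ (c * n) := by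
    have : (2 : ℝ) ^ (c * n) = (2 : ℝ) ^ (c / 2 * n) * (2 : ℝ) ^ (c / 2 * n) := by
      rw [← Real.rpow_add (by norm_num)]; ring_nf
    rw [this]
    have h2 : (2 : ℝ) ≤ (2 : ℝ) ^ (c / 2 * n) := by
      calc (2 : ℝ) = (2 : ℝ) ^ (1 : ℝ) := (Real.rpow_one 2).symm
        _ ≤ (2 : ℝ) ^ (c / 2 * n) := Real.rpow_le_rpow_of_exponent_le (by norm_num) hcn
    have h0 : (0 : ℝ) ≤ (2 : ℝ) ^ (c / 2 * n) := (Real.rpow_pos_of_pos (by norm_num) _).le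
    nlinarith
  have hr1 : (1 : ℝ) ≤ r := by
    by_contra hlt
    have hr0 : r = 0 := by
      have : (r : ℝ) < 1 := lt_of_not_ge hlt
      exact_mod_cast Nat.lt_one_iff.1 (by exact_mod_cast this)
    subst hr0
    have hcn' : (0 : ℝ) < c * n := by
      have : c / 2 * n = c * n / 2 := by ring
      linarith
    have h0 : (1 : ℝ) < (2 : ℝ) ^ (c * n) := Real.one_lt_rpow (by norm_num) hcn'
    simp at h1
    linarith
  linarith

end Literature.Barriers.PneNP

end
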